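import Literature.NumberTheory.LFunctions.WeilCriterionConverseDirichlet
import Literature.NumberTheory.LFunctions.WeilExplicitRightEdge
import Literature.NumberTheory.LFunctions.ExplicitFormulaPsiCharContour
import Literature.NumberTheory.LFunctions.CharZeroSum
import Literature.Analysis.Complex.WeightedArgumentPrinciple
import HarnessLib

/-!
# Proof of Weil's explicit formula for a primitive Dirichlet character
# (`Literature.NumberTheory.LFunctions.explicit_formula_dirichlet`)

DISCHARGE of the named fact `Literature.NumberTheory.LFunctions.explicit_formula_dirichlet`
(`WeilExplicitDirichlet.lean`): for `χ` primitive modulo `q ≠ 1` and every smooth compactly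
supported `g`,
`lim_{T→∞} Σ_{L(ρ,χ)=0, 0<Re ρ<1, |Im ρ|≤T} m(ρ) ĝ(ρ)
   = −Σₙ Λ(n) n^{−1/2}[χ(n) g(log n) + χ̄(n) g(−log n)] + (1/2π)∫ ĝ(1/2+it) Re ψ((1/2+a+it)/2) dt
     + g(0) log(q/π)`.

The proof is the contour-integral argument of E. Bombieri, *Remarks on Weil's quadratic functional
in the theory of prime numbers I*, Rend. Lincei (9) 11 (2000), §2 (Weil 1952, pp. 261–262, (11) for
`k = ℚ`), written for `ζ` in the tree's `WeilExplicitFormulaProofs.lean` and transposed here line by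
line to Mathlib's completed `L`-function `Λ(s, χ) = DirichletCharacter.completedLFunction χ s`
(entire for `χ ≠ χ₀`; its zeros are exactly the zeros of `L(s, χ)` in the open critical strip):

* the right edge `Re s = 3/2`: `Λ'/Λ(s, χ) = −Σ χ(n)Λ(n)n^{-s} − (log π)/2 + ½ψ((s+a)/2)`
  (`logDeriv_completedLFunction_eq`); after folding the left edge with the logarithmic derivative
  of the functional equation `Λ'/Λ(1−s, χ) = −log q − Λ'/Λ(s, χ̄)` (the tree's
  `ExplicitPsiChar.logDeriv_completed_one_sub`) the weight of the `χ̄`-part is `ĝ(1 − s)`, the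
  transform of `g(−·)`; Mellin inversion term by term (`integral_LSeries_twist_mul_weilMellin`),
  `∫ ĝ = 2π g(0)` for the `log q`, `log π` terms, and the shift of the Gamma term
  `½ψ((s+a)/2) k̂(s)`, `k̂ = ĝ + ĝ(1−·)`, from `Re s = 3/2` to `Re s = 1/2`
  (`integral_digammaShift_mul_weilMellin_weilSymm`, the parity-`a` copy of the tree's
  `integral_digamma_mul_weilMellin_weilSymm`) give `∫ (right edge) = 2π · weilFunctionalChar χ g`
  (`integral_rightEdge`);
* the residue theorem with weight (`Literature.Analysis.Complex.integral_boundary_rect_logDeriv_mul`)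
  on `[−1/2, 3/2] × [−T, T]` at a good height (`weilZeroSidePartialChar_eq_contour`);
* good heights `T ∈ [N, N+1]` at distance `≫ 1/log(qT)` from the ordinates
  (`ExplicitPsiChar.exists_goodHeight`), where `|Λ'/Λ| ≪ log²(qT)` on the horizontal sides
  (`exists_norm_logDeriv_completed_le_strip`, from the tree's MV Lemma 12.7
  `ExplicitPsiChar.exists_norm_logDeriv_LFunction_le_strip` and the Gamma-factor bound), against
  `|ĝ| ≪ (1+T²)^{-3}` (`norm_weilMellin_le_cube`): the horizontal sides tend to `0`;
* the zero side converges absolutely (`Σ m(ρ)/(1+γ²) < ∞`, `CharZeroSum.lean`;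
  `WeilConverseChar.hasWeilZeroSideChar_tsum`), so its limit along all `T` is the limit along the
  good heights: `explicit_formula_dirichlet_holds`.

With the converse half already in the tree (`WeilCriterionConverseDirichlet.lean`) this makes
**Weil's criterion for `L(s, χ)` on `C_c^∞` unconditional**: `weil_criterion_dirichlet`
(`GRH(χ) ↔ WeilPositivityChar χ`) and `riemannHypothesis_iff_forall_weilPositivityOnChar_holds`
(`GRH(χ) ↔` every compact-support rung `WeilPositivityOnChar χ t`).

## References

* A. Weil, *Sur les "formules explicites" de la théorie des nombres premiers*, Comm. Sém. Math.
  Univ. Lund (1952), 252–265, (11) pp. 261–262. [Weil1952FormulesExplicites]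
* E. Bombieri, *Remarks on Weil's quadratic functional in the theory of prime numbers I*, Rend.
  Mat. Acc. Lincei (9) 11 (2000), 183–233, §2. [Bombieri2000Weil]
* H. L. Montgomery, R. C. Vaughan, *Multiplicative Number Theory I* (2007), Cor. 10.8, (10.35),
  Lemma 12.7, Theorem 12.13. [MontgomeryVaughan2007]
-/

noncomputable section

open Complex Filter Set MeasureTheory LSeries
open scoped Real Topology ComplexConjugate LSeries.notation ArithmeticFunction.vonMangoldt

namespace Literature.NumberTheory.LFunctions

namespace WeilExplicitDirichletProofs

open DirichletCharacter Literature.NumberTheory.LFunctions.SiegelZero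
  Literature.NumberTheory.LFunctions.ExplicitPsiChar

variable {g : ℝ → ℂ}

/-! ### The Gamma term with parity `a`: shifting `∫ ½ψ((s+a)/2) k̂(s)` from `Re s = 3/2` to `Re s = 1/2` -/

/-- The integrand `Ψ_a(s) = ½ ψ((s+a)/2) k̂(s)` is holomorphic on `Re s > 0` (`a ≥ 0`). [folklore] -/
private theorem differentiableOn_digammaShift_mul_weilMellin {k : ℝ → ℂ} (hk : IsWeilTest k) {a : ℝ}
    (ha : 0 ≤ a) :
    DifferentiableOn ℂ (fun s : ℂ ↦ 1 / 2 * digamma ((s + a) / 2) * weilMellin k s)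
      {s : ℂ | 0 < s.re} := by
  refine DifferentiableOn.mul (DifferentiableOn.mul (differentiableOn_const _) ?_)
    (differentiable_weilMellin hk.1.continuous hk.2).differentiableOn
  exact Literature.Analysis.SpecialFunctions.Complex.differentiableOn_digamma.comp
    ((differentiableOn_id.add_const _).div_const 2)
    fun s hs ↦ by
      simp only [mem_setOf_eq, div_ofNat_re, add_re, ofReal_re] at hs ⊢
      positivity

/-- Horizontal sides of the shift: for `|T| ≥ 1`, `x ∈ [1/2, 3/2]`, `0 ≤ a ≤ 1`,
`‖Ψ_a(x + iT)‖ ≤ ½ (log(|T|+4) + 8) · D_k/(1+T²)`. [folklore] -/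
private theorem norm_digammaShift_mul_weilMellin_le {k : ℝ → ℂ} (hk : IsWeilTest k) {a : ℝ} (ha0 : 0 ≤ a)
    (ha1 : a ≤ 1) {T : ℝ} (hT : 1 ≤ |T|) {x : ℝ} (hx : x ∈ Icc (1 / 2 : ℝ) (3 / 2)) :
    ‖1 / 2 * digamma (((x : ℂ) + T * I + a) / 2) * weilMellin k (x + T * I)‖ ≤
      1 / 2 * (Real.log (|T| + 4) + 8) * (weilDecayW 1 k / (1 + T ^ 2)) := by
  set w : ℂ := ((x : ℂ) + T * I + a) / 2 with hw
  have hwre : 0 < w.re := by simp [hw]; linarith [hx.1]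
  have hwim : 1 / 2 ≤ |w.im| := by
    have : w.im = T / 2 := by simp [hw]
    rw [this, abs_div, abs_two]; linarith
  have hwn : ‖w‖ ≤ |T| + 3 := by
    have e : (x : ℂ) + T * I + a = ((x + a : ℝ) : ℂ) + T * I := by push_cast; ring
    have h1 : ‖(x : ℂ) + T * I + a‖ ≤ |x + a| + |T| := by
      rw [e]
      refine (norm_add_le _ _).trans (le_of_eq ?_)
      rw [Complex.norm_real, Real.norm_eq_abs, norm_mul, Complex.norm_I, mul_one, Complex.norm_real,
        Real.norm_eq_abs]
    have h2 : ‖w‖ = ‖(x : ℂ) + T * I + a‖ / 2 := by simp [hw]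
    have hx' : |x + a| ≤ 5 / 2 := abs_le.2 ⟨by linarith [hx.1], by linarith [hx.2]⟩
    rw [h2]; linarith [norm_nonneg ((x : ℂ) + T * I + a), abs_nonneg T]
  have hψ := norm_digamma_le_log_height hwre hwim hwn
  have hk' : ‖weilMellin k (x + T * I)‖ ≤ weilDecayW 1 k / (1 + T ^ 2) := by
    have := norm_weilMellin_le_of_abs_re_le hk (A := 1) (s := x + T * I)
      (by simp; exact abs_le.2 ⟨by linarith [hx.1], by linarith [hx.2]⟩)
    simpa using this
  rw [norm_mul, norm_mul]
  have : ‖(1 / 2 : ℂ)‖ = 1 / 2 := by simp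
  rw [this]
  gcongr
  · exact mul_nonneg (by norm_num) (by linarith [norm_nonneg (digamma w)])

/-- The horizontal sides of the shift tend to `0`. [folklore] -/
private theorem tendsto_horizontal_digammaShift_mul_weilMellin {k : ℝ → ℂ} (hk : IsWeilTest k) {a : ℝ}
    (ha0 : 0 ≤ a) (ha1 : a ≤ 1) {e : ℝ} (he : e = 1 ∨ e = -1) :
    Tendsto (fun T : ℝ ↦ ∫ x : ℝ in (1 / 2 : ℝ)..(3 / 2),
      1 / 2 * digamma (((x : ℂ) + (e * T : ℝ) * I + a) / 2) * weilMellin k (x + (e * T : ℝ) * I))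
      atTop (𝓝 0) := by
  set D := weilDecayW 1 k with hD
  have hD0 : 0 ≤ D := weilDecayW_nonneg _ _
  have habs : ∀ T : ℝ, |e * T| = |T| := by
    rcases he with rfl | rfl <;> intro T <;> simp
  rw [tendsto_zero_iff_norm_tendsto_zero]
  refine squeeze_zero' (g := fun T : ℝ ↦ 13 / 2 * D * T⁻¹) (Eventually.of_forall fun _ ↦ norm_nonneg _)
    ((eventually_ge_atTop (1 : ℝ)).mono fun T hT ↦ ?_) ?_
  · have hT' : 1 ≤ |e * T| := by rw [habs, abs_of_pos (by linarith)]; exact hT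
    have h := intervalIntegral.norm_integral_le_of_norm_le_const (a := (1 / 2 : ℝ)) (b := 3 / 2)
      (C := 1 / 2 * (Real.log (|e * T| + 4) + 8) * (D / (1 + (e * T) ^ 2)))
      (f := fun x : ℝ ↦ 1 / 2 * digamma (((x : ℂ) + (e * T : ℝ) * I + a) / 2) *
        weilMellin k (x + (e * T : ℝ) * I)) fun x hx ↦ by
        have hx' : x ∈ Icc (1 / 2 : ℝ) (3 / 2) := by
          rw [uIoc_of_le (by norm_num)] at hx; exact ⟨hx.1.le, hx.2⟩
        exact norm_digammaShift_mul_weilMellin_le hk ha0 ha1 hT' hx'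
    refine h.trans ?_
    rw [habs, abs_of_pos (by linarith : (0 : ℝ) < T), show |(3 : ℝ) / 2 - 1 / 2| = 1 by norm_num,
      mul_one, show (e * T) ^ 2 = T ^ 2 by rcases he with rfl | rfl <;> ring]
    have hlog : Real.log (T + 4) ≤ T + 4 := (Real.log_le_sub_one_of_pos (by linarith)).trans (by linarith)
    have h1 : 1 / 2 * (Real.log (T + 4) + 8) ≤ 13 / 2 * T := by nlinarith
    have h2 : D / (1 + T ^ 2) ≤ D / T ^ 2 := div_le_div_of_nonneg_left hD0 (by positivity) (by linarith)
    calc 1 / 2 * (Real.log (T + 4) + 8) * (D / (1 + T ^ 2))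
        ≤ 13 / 2 * T * (D / T ^ 2) := mul_le_mul h1 h2 (by positivity) (by positivity)
      _ = 13 / 2 * D * T⁻¹ := by field_simp
  · have := (tendsto_inv_atTop_zero (𝕜 := ℝ)).const_mul (13 / 2 * D)
    simpa using this

/-- Integrability of `y ↦ ½ψ((c+a ± iy)/2) ĥ(c+iy)` on a line `Re s = c > 0` (`a ≥ 0`). [folklore] -/
private theorem integrable_digammaShift_mul_weilMellin_vertical {h : ℝ → ℂ} (hh : IsWeilTest h) {c : ℝ}
    (hc : 0 < c) {a : ℝ} (ha : 0 ≤ a) (e : ℝ) (he : e = 1 ∨ e = -1) :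
    Integrable fun y : ℝ ↦
      1 / 2 * digamma (((c : ℂ) + (e * y : ℝ) * I + a) / 2) * weilMellin h (c + y * I) := by
  obtain ⟨C, hC⟩ := Literature.Analysis.SpecialFunctions.Complex.exists_norm_digamma_vertical_le
    (a := (c + a) / 2) (by positivity)
  have habs : ∀ y : ℝ, |e * y| = |y| := by
    rcases he with rfl | rfl <;> intro y <;> simp
  refine integrable_mul_weilMellin_vertical_of_norm_le_log hh c ?_ (C := |C|) fun y ↦ ?_
  · refine continuous_const.mul
      (Literature.Analysis.SpecialFunctions.Complex.continuousOn_digamma.comp_continuous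
        (by fun_prop) fun y ↦ ?_)
    simp only [mem_setOf_eq, div_ofNat_re, add_re, ofReal_re]
    simp; positivity
  · have hw : ((c : ℂ) + (e * y : ℝ) * I + a) / 2 =
        (((c + a) / 2 : ℝ) : ℂ) + ((e * y / 2 : ℝ) : ℂ) * I := by
      push_cast; ring
    rw [norm_mul, hw]
    have h1 := hC (e * y / 2)
    have h2 : Real.log (1 + |e * y / 2|) ≤ Real.log (1 + |y|) := by
      refine Real.log_le_log (by positivity) ?_
      rw [abs_div, habs, abs_two]; linarith [abs_nonneg y]
    have h3 : ‖(1 / 2 : ℂ)‖ = 1 / 2 := by simp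
    rw [h3]
    have h0 : 0 ≤ Real.log (1 + |y|) := Real.log_nonneg (by linarith [abs_nonneg y])
    nlinarith [le_abs_self C, norm_nonneg (digamma ((((c + a) / 2 : ℝ) : ℂ) + ((e * y / 2 : ℝ) : ℂ) * I))]

/-- **The line of the Gamma term can be shifted** (parity `a ∈ [0, 1]`):
`∫ ½ψ((3/2+a+iy)/2) k̂(3/2+iy) dy = ∫ ½ψ((1/2+a+iy)/2) k̂(1/2+iy) dy` (Cauchy's theorem on
`[1/2, 3/2] × [−T, T]`, no poles of `ψ((s+a)/2)` in `Re s > 0`, horizontal sides `→ 0`).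
[cite: Bombieri2000Weil, §2] -/
theorem integral_digammaShift_mul_weilMellin_shift {k : ℝ → ℂ} (hk : IsWeilTest k) {a : ℝ}
    (ha0 : 0 ≤ a) (ha1 : a ≤ 1) :
    ∫ y : ℝ, 1 / 2 * digamma ((((3 / 2 : ℝ) : ℂ) + y * I + a) / 2) *
        weilMellin k (((3 / 2 : ℝ) : ℂ) + y * I) =
      ∫ y : ℝ, 1 / 2 * digamma ((((1 / 2 : ℝ) : ℂ) + y * I + a) / 2) *
        weilMellin k (((1 / 2 : ℝ) : ℂ) + y * I) := by
  set Ψ : ℂ → ℂ := fun s ↦ 1 / 2 * digamma ((s + a) / 2) * weilMellin k s with hΨ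
  -- Cauchy on `[1/2, 3/2] × [−T, T]`
  have hrect : ∀ T : ℝ, (∫ x : ℝ in (1 / 2 : ℝ)..(3 / 2), Ψ (x + (-T : ℝ) * I)) -
      (∫ x : ℝ in (1 / 2 : ℝ)..(3 / 2), Ψ (x + (T : ℝ) * I)) +
      I * (∫ y : ℝ in (-T)..T, Ψ ((3 / 2 : ℝ) + y * I)) -
      I * (∫ y : ℝ in (-T)..T, Ψ ((1 / 2 : ℝ) + y * I)) = 0 := by
    intro T
    have := integral_boundary_rect_eq_zero' Ψ (a := 1 / 2) (b := 3 / 2) (c := -T) (d := T)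
      ((differentiableOn_digammaShift_mul_weilMellin hk ha0).mono fun s hs ↦ by
        have h1 := hs.1
        rw [uIcc_of_le (by norm_num : (1 / 2 : ℝ) ≤ 3 / 2)] at h1
        simp only [mem_setOf_eq]
        linarith [h1.1])
    simpa using this
  -- limits of the four sides
  have hbot : Tendsto (fun T : ℝ ↦ ∫ x : ℝ in (1 / 2 : ℝ)..(3 / 2), Ψ (x + (-T : ℝ) * I)) atTop (𝓝 0) := by
    have := tendsto_horizontal_digammaShift_mul_weilMellin hk ha0 ha1 (e := -1) (Or.inr rfl)
    refine this.congr fun T ↦ ?_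
    simp [hΨ]
  have htop : Tendsto (fun T : ℝ ↦ ∫ x : ℝ in (1 / 2 : ℝ)..(3 / 2), Ψ (x + (T : ℝ) * I)) atTop (𝓝 0) := by
    have := tendsto_horizontal_digammaShift_mul_weilMellin hk ha0 ha1 (e := 1) (Or.inl rfl)
    refine this.congr fun T ↦ ?_
    simp [hΨ]
  have hvert : ∀ c : ℝ, 0 < c → Tendsto (fun T : ℝ ↦ ∫ y : ℝ in (-T)..T, Ψ (c + y * I)) atTop
      (𝓝 (∫ y : ℝ, Ψ (c + y * I))) := by
    intro c hc
    have hint : Integrable fun y : ℝ ↦ Ψ (c + y * I) := by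
      have := integrable_digammaShift_mul_weilMellin_vertical hk hc ha0 1 (Or.inl rfl)
      refine this.congr (Eventually.of_forall fun y ↦ ?_)
      simp [hΨ]
    exact intervalIntegral_tendsto_integral hint tendsto_neg_atTop_atBot tendsto_id
  have hlim : Tendsto (fun T : ℝ ↦ (∫ x : ℝ in (1 / 2 : ℝ)..(3 / 2), Ψ (x + (-T : ℝ) * I)) -
      (∫ x : ℝ in (1 / 2 : ℝ)..(3 / 2), Ψ (x + (T : ℝ) * I)) +
      I * (∫ y : ℝ in (-T)..T, Ψ ((3 / 2 : ℝ) + y * I)) -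
      I * (∫ y : ℝ in (-T)..T, Ψ ((1 / 2 : ℝ) + y * I))) atTop
      (𝓝 (0 - 0 + I * (∫ y : ℝ, Ψ ((3 / 2 : ℝ) + y * I)) - I * (∫ y : ℝ, Ψ ((1 / 2 : ℝ) + y * I)))) :=
    ((hbot.sub htop).add ((hvert _ (by norm_num)).const_mul I)).sub ((hvert _ (by norm_num)).const_mul I)
  have h0 : (0 : ℂ) - 0 + I * (∫ y : ℝ, Ψ ((3 / 2 : ℝ) + y * I)) - I * (∫ y : ℝ, Ψ ((1 / 2 : ℝ) + y * I)) = 0 :=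
    tendsto_nhds_unique hlim (by simp_rw [hrect]; exact tendsto_const_nhds)
  have : (∫ y : ℝ, Ψ ((3 / 2 : ℝ) + y * I)) = ∫ y : ℝ, Ψ ((1 / 2 : ℝ) + y * I) := by
    have h1 : I * ((∫ y : ℝ, Ψ ((3 / 2 : ℝ) + y * I)) - ∫ y : ℝ, Ψ ((1 / 2 : ℝ) + y * I)) = 0 := by
      rw [mul_sub]; simpa using h0
    exact sub_eq_zero.1 ((mul_eq_zero.1 h1).resolve_left I_ne_zero)
  simpa [hΨ] using this

/-- **The Gamma term with parity equals the archimedean integral**: for `a ∈ {0, 1}`,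
`∫ ½ψ((3/2+a+iy)/2) k̂(3/2+iy) dy = ∫ ĝ(1/2+it) Re ψ(1/4 + a/2 + it/2) dt = weilArchIntegralChar a g`
(shift to `Re s = 1/2`, `k̂(1/2+iy) = ĝ(1/2+iy) + ĝ(1/2−iy)`, `y ↦ −y`, and
`½(ψ(w) + ψ(w̄)) = Re ψ(w)`; Weil (10): the kernel `Re ψ((1/2+a+it)/2)`).
[cite: Weil1952FormulesExplicites, (10) p. 258; Bombieri2000Weil, §2] -/
theorem integral_digammaShift_mul_weilMellin_weilSymm (hg : IsWeilTest g) {a : ℕ} (ha : a ≤ 1) :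
    ∫ y : ℝ, 1 / 2 * digamma ((((3 / 2 : ℝ) : ℂ) + y * I + a) / 2) *
        weilMellin (weilSymm g) (((3 / 2 : ℝ) : ℂ) + y * I) = weilArchIntegralChar a g := by
  have hk : IsWeilTest (weilSymm g) := hg.weilSymm
  have ha0 : (0 : ℝ) ≤ (a : ℝ) := Nat.cast_nonneg a
  have ha1 : (a : ℝ) ≤ 1 := by exact_mod_cast ha
  have hshift := integral_digammaShift_mul_weilMellin_shift hk ha0 ha1
  simp only [Complex.ofReal_natCast] at hshift
  rw [hshift]
  set c : ℝ := 1 / 2 with hc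
  -- split `k̂(1/2+iy) = ĝ(1/2+iy) + ĝ(1/2-iy)`
  have hrefl : ∀ y : ℝ, 1 - ((c : ℂ) + y * I) = (c : ℂ) + ((-y : ℝ) : ℂ) * I := by
    intro y; simp only [hc]; push_cast; ring
  set A : ℝ → ℂ := fun y ↦ 1 / 2 * digamma (((c : ℂ) + y * I + a) / 2) * weilMellin g (c + y * I)
    with hA
  set B : ℝ → ℂ := fun y ↦ 1 / 2 * digamma (((c : ℂ) + ((-y : ℝ) : ℂ) * I + a) / 2) *
    weilMellin g (c + y * I) with hB
  have hAi : Integrable A := by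
    have := integrable_digammaShift_mul_weilMellin_vertical hg (c := c) (by norm_num) ha0 1 (Or.inl rfl)
    refine this.congr (Eventually.of_forall fun y ↦ ?_); simp [hA]
  have hBi : Integrable B := by
    have := integrable_digammaShift_mul_weilMellin_vertical hg (c := c) (by norm_num) ha0 (-1)
      (Or.inr rfl)
    refine this.congr (Eventually.of_forall fun y ↦ ?_); simp [hB]
  have hsplit : (fun y : ℝ ↦ 1 / 2 * digamma (((c : ℂ) + y * I + a) / 2) *
      weilMellin (weilSymm g) (c + y * I)) = fun y : ℝ ↦ A y + B (-y) := by
    funext y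
    rw [weilMellin_weilSymm hg, hrefl y]
    simp only [hA, hB, neg_neg]
    push_cast
    ring
  rw [hsplit, integral_add hAi hBi.comp_neg, integral_neg_eq_self B volume, ← integral_add hAi hBi]
  -- combine `½ψ(w) + ½ψ(w̄) = Re ψ(w)`
  unfold weilArchIntegralChar
  congr 1 with y
  have hw : ((c : ℂ) + ((-y : ℝ) : ℂ) * I + a) / 2 = conj (((c : ℂ) + y * I + a) / 2) := by
    simp only [map_div₀, map_add, map_mul, Complex.conj_ofReal, Complex.conj_I, map_ofNat,
      Complex.conj_natCast]
    push_cast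
    ring
  have hw' : ((c : ℂ) + y * I + a) / 2 = 1 / 4 + (a : ℂ) / 2 + y / 2 * I := by
    simp only [hc]; push_cast; ring
  have hs' : (c : ℂ) + y * I = 1 / 2 + y * I := by
    simp only [hc]; push_cast; ring
  simp only [hA, hB]
  have hψ : ∀ w : ℂ, digamma w + digamma (conj w) = 2 * ((digamma w).re : ℂ) := fun w ↦ by
    rw [Literature.NumberTheory.LFunctions.digamma_conj, Complex.add_conj]; push_cast; ring
  rw [hw, ← add_mul, ← mul_add, hψ, hw', hs']
  ring


/-! ### The prime terms, twisted -/

/-- **The twisted prime terms** (Bombieri (2.2) `(1/2πi)∫ f̃(s) n^{-s} ds = f(n)` summed against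
`ψ(n)Λ(n)` with `|ψ| ≤ 1`): on `s = 3/2 + iy`,
`∫ (Σₙ ψ(n)Λ(n) n^{-s}) ĥ(s) dy = 2π Σₙ Λ(n) n^{-1/2} ψ(n) h(log n)`, and the series on the right
converges (the interchange is justified by `Σ Λ(n) n^{-3/2} ∫ |ĥ| < ∞`).
[cite: Bombieri2000Weil, §2 eq. (2.2)] -/
theorem integral_LSeries_twist_mul_weilMellin {h : ℝ → ℂ} (hh : IsWeilTest h) {ψ : ℕ → ℂ}
    (hψ : ∀ n, ‖ψ n‖ ≤ 1) :
    (∫ y : ℝ, L (fun n ↦ ψ n * Λ n) (((3 / 2 : ℝ) : ℂ) + y * I) *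
        weilMellin h (((3 / 2 : ℝ) : ℂ) + y * I) =
      2 * π * ∑' n : ℕ, ((Λ n : ℝ) : ℂ) / (Real.sqrt n : ℂ) * (ψ n * h (Real.log n))) ∧
    Summable fun n : ℕ ↦ ((Λ n : ℝ) : ℂ) / (Real.sqrt n : ℂ) * (ψ n * h (Real.log n)) := by
  set c : ℝ := 3 / 2 with hc
  set f : ℕ → ℂ := fun n ↦ ψ n * Λ n with hf
  -- the summands
  set F : ℕ → ℝ → ℂ := fun n y ↦ weilMellin h (c + y * I) * term f (c + y * I) n with hF
  have hle : ∀ n, ‖term f (c : ℂ) n‖ ≤ ‖term ↗Λ (c : ℂ) n‖ := by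
    intro n
    rcases eq_or_ne n 0 with rfl | hn
    · simp [term_zero]
    rw [term_of_ne_zero hn, term_of_ne_zero hn, norm_div, norm_div, hf]
    refine div_le_div_of_nonneg_right ?_ (norm_nonneg _)
    rw [norm_mul]
    exact mul_le_of_le_one_left (norm_nonneg _) (hψ n)
  have hFint : ∀ n, Integrable (F n) := fun n ↦
    integrable_weilMellin_vertical_mul hh c (continuous_term_vertical _ c n)
      (B := ‖term f (c : ℂ) n‖) fun y ↦ (norm_term_vertical _ c y n).le
  have hnorm : ∀ n, (∫ y : ℝ, ‖F n y‖) =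
      (∫ y : ℝ, ‖weilMellin h (c + y * I)‖) * ‖term f (c : ℂ) n‖ := by
    intro n
    rw [← integral_mul_const]
    congr 1 with y
    rw [hF, norm_mul, norm_term_vertical]
  have hsum : Summable fun n ↦ ∫ y : ℝ, ‖F n y‖ := by
    simp_rw [hnorm]
    refine Summable.mul_left _ ?_
    have h3 := ArithmeticFunction.LSeriesSummable_vonMangoldt (s := (c : ℂ)) (by simp [hc]; norm_num)
    exact Summable.of_nonneg_of_le (fun _ ↦ norm_nonneg _) hle (summable_norm_iff.mpr h3)
  have hswap := integral_tsum_of_summable_integral_norm hFint hsum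
  -- each summand integrates to `2π Λ(n) n^{-1/2} ψ(n) h(log n)`
  have hterm : ∀ n : ℕ, (∫ y : ℝ, F n y) =
      2 * π * (((Λ n : ℝ) : ℂ) / (Real.sqrt n : ℂ) * (ψ n * h (Real.log n))) := by
    intro n
    rcases eq_or_ne n 0 with rfl | hn
    · simp [hF, term_zero]
    have e : F n = fun y : ℝ ↦ f n *
        (weilMellin h (c + y * I) * (n : ℂ) ^ (-((c : ℂ) + y * I))) := by
      funext y
      simp only [hF, term_of_ne_zero hn, cpow_neg, div_eq_mul_inv]
      ring
    rw [e, integral_const_mul, integral_weilMellin_vertical_mul_natCast_cpow hh c hn, hf]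
    ring
  refine ⟨?_, ?_⟩
  · calc ∫ y : ℝ, L f ((c : ℂ) + y * I) * weilMellin h (c + y * I)
        = ∫ y : ℝ, ∑' n : ℕ, F n y := by
          congr 1 with y
          rw [hF, LSeries, mul_comm, ← tsum_mul_left]
      _ = ∑' n : ℕ, ∫ y : ℝ, F n y := hswap.symm
      _ = ∑' n : ℕ, 2 * π * (((Λ n : ℝ) : ℂ) / (Real.sqrt n : ℂ) * (ψ n * h (Real.log n))) :=
          tsum_congr hterm
      _ = _ := by rw [tsum_mul_left]
  · have h1 : Summable fun n : ℕ ↦ ∫ y : ℝ, F n y :=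
      hsum.of_norm_bounded fun n ↦ norm_integral_le_integral_norm _
    simp_rw [hterm] at h1
    exact (summable_mul_left_iff (by simp [Real.pi_ne_zero] : (2 * π : ℂ) ≠ 0)).1 h1

/-! ### `Λ'/Λ(s, χ)` on the right edge -/

variable {q : ℕ} [NeZero q] {χ : DirichletCharacter ℂ q}

omit [NeZero q] in
/-- `(s + a)/2` is no pole of `ψ` for `Re s > 0`, `a ≥ 0`. [folklore] -/
private theorem half_add_ne_neg_nat {s : ℂ} (hs : 0 < s.re) {a : ℝ} (ha : 0 ≤ a) (m : ℕ) :
    (s + a) / 2 ≠ -m := by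
  intro h
  have := congrArg Complex.re h
  simp at this
  linarith

/-- `γ(s, χ) ≠ 0` and `γ'/γ(s, χ) = Γ_ℝ'/Γ_ℝ(s + a_χ)` for `Re s > 0`, `a_χ = charParity χ`
(Mathlib's Gamma factor is `Γ_ℝ(s)` for even `χ`, `Γ_ℝ(s+1)` for odd `χ`). [folklore] -/
private theorem gammaFactor_ne_zero_and_logDeriv (χ : DirichletCharacter ℂ q) {s : ℂ} (hs : 0 < s.re) :
    gammaFactor χ s ≠ 0 ∧
      logDeriv (gammaFactor χ) s = logDeriv Gammaℝ (s + charParity χ) := by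
  rcases χ.even_or_odd with h | h
  · have hfun : gammaFactor χ = Gammaℝ := funext fun z ↦ h.gammaFactor_def z
    rw [hfun, charParity_of_even h]
    exact ⟨Gammaℝ_ne_zero_of_re_pos hs, by simp⟩
  · have hfun : gammaFactor χ = Gammaℝ ∘ fun z ↦ z + 1 := funext fun z ↦ h.gammaFactor_def z
    rw [hfun, charParity_of_odd h]
    simp only [Nat.cast_one, Function.comp_apply]
    have hs1 : 0 < (s + 1).re := by simp; linarith
    have hd : DifferentiableAt ℂ Gammaℝ (s + 1) :=
      (RealZeros.hasDerivAt_Gammaℝ fun m ↦ by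
        have := half_add_ne_neg_nat hs zero_le_one m
        simpa using this).differentiableAt
    have hd2 : DifferentiableAt ℂ (fun z : ℂ ↦ z + 1) s := differentiableAt_id.add_const 1
    refine ⟨Gammaℝ_ne_zero_of_re_pos hs1, ?_⟩
    rw [logDeriv_comp (f := Gammaℝ) (g := fun z : ℂ ↦ z + 1) (x := s) hd hd2]
    simp

/-- **`L'/L(s, χ) = −Σ χ(n)Λ(n) n^{-s}`** on `Re s > 1` (Mathlib's
`DirichletCharacter.LSeries_twist_vonMangoldt_eq`). [cite: MontgomeryVaughan2007, Theorem 12.10 (proof)] -/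
theorem logDeriv_LFunction_eq_neg_LSeries (χ : DirichletCharacter ℂ q) {s : ℂ} (hs : 1 < s.re) :
    logDeriv χ.LFunction s = -L (fun n ↦ χ n * Λ n) s := by
  have hf : (fun n : ℕ ↦ χ n * (Λ n : ℂ)) = (fun n : ℕ ↦ χ n) * fun n : ℕ ↦ (Λ n : ℂ) := rfl
  rw [logDeriv_apply, deriv_LFunction_eq_deriv_LSeries χ hs, LFunction_eq_LSeries χ hs, hf,
    DirichletCharacter.LSeries_twist_vonMangoldt_eq χ hs]
  ring

/-- **`Λ'/Λ = L'/L − (log π)/2 + ½ψ((s + a)/2)`** on `Re s ≥ 1` (`χ ≠ χ₀`, `a = charParity χ`;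
MV (10.35) `L'/L = Λ'/Λ − γ'/γ`, `γ'/γ(s) = Γ_ℝ'/Γ_ℝ(s+a) = −(log π)/2 + ½ψ((s+a)/2)`).
[cite: MontgomeryVaughan2007, (10.35)] -/
theorem logDeriv_completedLFunction_eq (hχ : χ ≠ 1) {s : ℂ} (hs : 1 ≤ s.re) :
    logDeriv (completedLFunction χ) s =
      logDeriv χ.LFunction s +
        (-(Real.log π : ℂ) / 2 + 1 / 2 * digamma ((s + charParity χ) / 2)) := by
  have hs0 : 0 < s.re := by linarith
  have hΛ := completedLFunction_ne_zero_of_one_le_re hχ hs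
  obtain ⟨hG, hlogG⟩ := gammaFactor_ne_zero_and_logDeriv χ hs0
  have hpole : ∀ m : ℕ, (s + charParity χ) / 2 ≠ -m := fun m ↦ by
    have := half_add_ne_neg_nat hs0 (Nat.cast_nonneg (charParity χ)) m
    simpa using this
  have hval := logDeriv_LFunction_eq hχ hΛ hG
  rw [hlogG, LFunctions.logDeriv_Gammaℝ hpole, ← Complex.ofReal_log Real.pi_pos.le] at hval
  linear_combination -hval

/-- `charParity χ⁻¹ = charParity χ`. [folklore] -/
private theorem charParity_inv (χ : DirichletCharacter ℂ q) : charParity χ⁻¹ = charParity χ := by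
  rcases χ.even_or_odd with h | h
  · rw [charParity_of_even h, charParity_of_even ((even_inv_iff χ).2 h)]
  · rw [charParity_of_odd h, charParity_of_odd ((odd_inv_iff χ).2 h)]

/-- `y ↦ L'/L(c + iy, χ)` is continuous for `c > 1` (`χ ≠ χ₀`). [folklore] -/
private theorem continuous_logDeriv_LFunction_vertical (hχ : χ ≠ 1) {c : ℝ} (hc : 1 < c) :
    Continuous fun y : ℝ ↦ logDeriv χ.LFunction ((c : ℂ) + y * I) := by
  refine continuous_iff_continuousAt.2 fun y ↦ ?_
  have hL : χ.LFunction ((c : ℂ) + y * I) ≠ 0 :=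
    LFunction_ne_zero_of_one_le_re χ (Or.inl hχ) (by simp; exact hc.le)
  have hcont : Continuous fun y : ℝ ↦ (c : ℂ) + y * I := by fun_prop
  exact ContinuousAt.comp (f := fun y : ℝ ↦ (c : ℂ) + y * I)
    (differentiableAt_logDeriv_LFunction hχ hL).continuousAt hcont.continuousAt

/-! ### The right edge -/

/-- **The right edge of the contour evaluates to `2π W_χ(g)`** (Weil (11) for `k = ℚ`; Bombieri §2
(2.2)–(2.4) with `χ`): for `χ ≠ χ₀` modulo `q ≠ 1` and a test function `g`, the function
`y ↦ Λ'/Λ(s, χ) ĝ(s) + (log q + Λ'/Λ(s, χ̄)) ĝ(1 − s)`, `s = 3/2 + iy`, is integrable and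
`∫ [Λ'/Λ(s, χ) ĝ(s) + (log q + Λ'/Λ(s, χ̄)) ĝ(1 − s)] dy = 2π · weilFunctionalChar χ g`.
[cite: Weil1952FormulesExplicites, (11) pp. 261–262; Bombieri2000Weil, §2 eq. (2.2)–(2.4)] -/
theorem integral_rightEdge (hq : q ≠ 1) (hχ : χ ≠ 1) (hg : IsWeilTest g) :
    Integrable (fun y : ℝ ↦ logDeriv (completedLFunction χ) (((3 / 2 : ℝ) : ℂ) + y * I) *
        weilMellin g (((3 / 2 : ℝ) : ℂ) + y * I) +
      ((Real.log q : ℂ) + logDeriv (completedLFunction χ⁻¹) (((3 / 2 : ℝ) : ℂ) + y * I)) *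
        weilMellin g (1 - (((3 / 2 : ℝ) : ℂ) + y * I))) ∧
    ∫ y : ℝ, (logDeriv (completedLFunction χ) (((3 / 2 : ℝ) : ℂ) + y * I) *
        weilMellin g (((3 / 2 : ℝ) : ℂ) + y * I) +
      ((Real.log q : ℂ) + logDeriv (completedLFunction χ⁻¹) (((3 / 2 : ℝ) : ℂ) + y * I)) *
        weilMellin g (1 - (((3 / 2 : ℝ) : ℂ) + y * I))) = 2 * π * weilFunctionalChar χ g := by
  have hk : IsWeilTest (weilSymm g) := hg.weilSymm
  have hgn : IsWeilTest (fun t ↦ g (-t)) := hg.comp_neg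
  have hχ' : χ⁻¹ ≠ 1 := inv_ne_one.mpr hχ
  set c : ℝ := 3 / 2 with hc
  have hc1 : ∀ y : ℝ, 1 ≤ ((c : ℂ) + y * I).re := fun y ↦ by simp [hc]; norm_num
  have hc1' : ∀ y : ℝ, 1 < ((c : ℂ) + y * I).re := fun y ↦ by simp [hc]; norm_num
  set a : ℕ := charParity χ with ha_def
  have ha1 : a ≤ 1 := charParity_le_one χ
  -- the five pieces
  set Z₁ : ℝ → ℂ := fun y ↦ weilMellin g (c + y * I) * logDeriv χ.LFunction ((c : ℂ) + y * I)
    with hZ₁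
  set Z₂ : ℝ → ℂ := fun y ↦ weilMellin (fun t ↦ g (-t)) (c + y * I) *
    logDeriv χ⁻¹.LFunction ((c : ℂ) + y * I) with hZ₂
  set Lπ : ℝ → ℂ := fun y ↦ (-(Real.log π : ℂ) / 2) * weilMellin (weilSymm g) (c + y * I) with hLπ
  set G : ℝ → ℂ := fun y ↦ 1 / 2 * digamma (((c : ℂ) + y * I + a) / 2) *
    weilMellin (weilSymm g) (c + y * I) with hG
  set Q : ℝ → ℂ := fun y ↦ (Real.log q : ℂ) * weilMellin (fun t ↦ g (-t)) (c + y * I) with hQ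
  set Φ : ℝ → ℂ := fun y ↦ logDeriv (completedLFunction χ) ((c : ℂ) + y * I) *
      weilMellin g (c + y * I) +
    ((Real.log q : ℂ) + logDeriv (completedLFunction χ⁻¹) ((c : ℂ) + y * I)) *
      weilMellin g (1 - ((c : ℂ) + y * I)) with hΦ
  have hdecomp : Φ = fun y ↦ Lπ y + G y + Q y + Z₁ y + Z₂ y := by
    funext y
    simp only [hΦ, hZ₁, hZ₂, hLπ, hG, hQ]
    rw [logDeriv_completedLFunction_eq hχ (hc1 y), logDeriv_completedLFunction_eq hχ' (hc1 y),
      charParity_inv, ← ha_def, weilMellin_weilSymm hg, weilMellin_comp_neg]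
    ring
  -- integrability
  have hZ₁i : Integrable Z₁ :=
    integrable_weilMellin_vertical_mul hg c (continuous_logDeriv_LFunction_vertical hχ (by norm_num))
      fun y ↦ norm_logDeriv_LFunction_le_of_re_ge χ (by simp [hc])
  have hZ₂i : Integrable Z₂ :=
    integrable_weilMellin_vertical_mul hgn c (continuous_logDeriv_LFunction_vertical hχ' (by norm_num))
      fun y ↦ norm_logDeriv_LFunction_le_of_re_ge χ⁻¹ (by simp [hc])
  have hLπi : Integrable Lπ := (integrable_weilMellin_vertical hk c).const_mul _
  have hGi : Integrable G := by
    have := integrable_digammaShift_mul_weilMellin_vertical hk (c := c) (by norm_num)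
      (Nat.cast_nonneg a) 1 (Or.inl rfl)
    refine this.congr (Eventually.of_forall fun y ↦ ?_)
    simp [hG]
  have hQi : Integrable Q := (integrable_weilMellin_vertical hgn c).const_mul _
  have hΦi : Integrable Φ := by
    rw [hdecomp]; exact (((hLπi.add hGi).add hQi).add hZ₁i).add hZ₂i
  -- the five evaluations
  have eLπ : (∫ y, Lπ y) = -(Real.log π : ℂ) / 2 * (2 * π * (2 * g 0)) :=
    integral_const_mul_weilMellin_weilSymm hg _ c
  have eG : (∫ y, G y) = weilArchIntegralChar a g :=
    integral_digammaShift_mul_weilMellin_weilSymm hg ha1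
  have eQ : (∫ y, Q y) = (Real.log q : ℂ) * (2 * π * g 0) := by
    simp only [hQ]
    rw [integral_const_mul, integral_weilMellin_vertical hgn c, neg_zero]
  obtain ⟨hI₁, hS₁⟩ := integral_LSeries_twist_mul_weilMellin hg (ψ := fun n : ℕ ↦ χ (n : ZMod q))
    fun n ↦ χ.norm_le_one _
  obtain ⟨hI₂, hS₂⟩ := integral_LSeries_twist_mul_weilMellin hgn (ψ := fun n : ℕ ↦ χ⁻¹ (n : ZMod q))
    fun n ↦ χ⁻¹.norm_le_one _
  have eZ₁ : (∫ y, Z₁ y) = -(2 * π * ∑' n : ℕ, ((Λ n : ℝ) : ℂ) / (Real.sqrt n : ℂ) *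
      (χ (n : ZMod q) * g (Real.log n))) := by
    rw [← hI₁, ← integral_neg]
    congr 1 with y
    simp only [hZ₁]
    rw [logDeriv_LFunction_eq_neg_LSeries χ (hc1' y)]
    ring
  have eZ₂ : (∫ y, Z₂ y) = -(2 * π * ∑' n : ℕ, ((Λ n : ℝ) : ℂ) / (Real.sqrt n : ℂ) *
      (χ⁻¹ (n : ZMod q) * g (-Real.log n))) := by
    rw [← hI₂, ← integral_neg]
    congr 1 with y
    simp only [hZ₂]
    rw [logDeriv_LFunction_eq_neg_LSeries χ⁻¹ (hc1' y)]
    ring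
  -- the prime term is the sum of the two twisted series
  have hP : weilPrimeTermChar χ g =
      (∑' n : ℕ, ((Λ n : ℝ) : ℂ) / (Real.sqrt n : ℂ) * (χ (n : ZMod q) * g (Real.log n))) +
      ∑' n : ℕ, ((Λ n : ℝ) : ℂ) / (Real.sqrt n : ℂ) * (χ⁻¹ (n : ZMod q) * g (-Real.log n)) := by
    rw [← hS₁.tsum_add hS₂, weilPrimeTermChar]
    refine tsum_congr fun n ↦ ?_
    rw [← MulChar.star_apply' χ (n : ZMod q)]
    simp only [RCLike.star_def]
    ring
  -- assemble
  refine ⟨hΦi, ?_⟩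
  change (∫ y, Φ y) = _
  have i2 : Integrable (fun y ↦ Lπ y + G y) := hLπi.add hGi
  have i3 : Integrable (fun y ↦ Lπ y + G y + Q y) := i2.add hQi
  have i4 : Integrable (fun y ↦ Lπ y + G y + Q y + Z₁ y) := i3.add hZ₁i
  rw [hdecomp, integral_add i4 hZ₂i, integral_add i3 hZ₁i, integral_add i2 hQi, integral_add hLπi hGi,
    eLπ, eG, eQ, eZ₁, eZ₂]
  simp only [weilFunctionalChar, weilArchTermChar, if_neg hq, hP, ← ha_def]
  have hπ : (π : ℂ) ≠ 0 := ofReal_ne_zero.2 Real.pi_ne_zero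
  push_cast
  field_simp
  ring

/-! ### Zeros of `Λ(s, χ)` and the contour identity at a good height -/

/-- A zero of `Λ(·, χ)` (primitive `χ ≠ χ₀`) is a zero of `L(·, χ)` in the open critical strip
(`Λ ≠ 0` on `Re s ≤ 0` and `Re s ≥ 1`; `L = Λ/γ`). [cite: MontgomeryVaughan2007, Corollary 10.8] -/
theorem LFunction_eq_zero_of_completed (hprim : χ.IsPrimitive) (hχ : χ ≠ 1) {ρ : ℂ}
    (h : completedLFunction χ ρ = 0) : χ.LFunction ρ = 0 ∧ 0 < ρ.re ∧ ρ.re < 1 := by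
  have h0 : 0 < ρ.re :=
    lt_of_not_ge fun hle ↦ completedLFunction_ne_zero_of_re_nonpos hprim hχ hle h
  have h1 : ρ.re < 1 := lt_of_not_ge fun hle ↦ completedLFunction_ne_zero_of_one_le_re hχ hle h
  refine ⟨?_, h0, h1⟩
  rw [LFunction_eq_completed_div_gammaFactor χ ρ (Or.inr (level_ne_one hχ)), h, zero_div]

/-- Conversely, a zero of `L(·, χ)` with `Re ρ > 0` is a zero of `Λ(·, χ)` (`γ(ρ, χ) ≠ 0` there).
[cite: MontgomeryVaughan2007, Corollary 10.8] -/
theorem completed_eq_zero_of_LFunction (hχ : χ ≠ 1) {ρ : ℂ} (h : χ.LFunction ρ = 0)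
    (h0 : 0 < ρ.re) : completedLFunction χ ρ = 0 := by
  have hG := (gammaFactor_ne_zero_and_logDeriv χ h0).1
  rw [LFunction_eq_completed_div_gammaFactor χ ρ (Or.inr (level_ne_one hχ)), div_eq_zero_iff] at h
  exact h.resolve_right hG

/-- **The multiplicity of a zero of `Λ(·, χ)` is `m_χ(ρ)`** (`Re ρ > 0`): `Λ` and `L` have the same
order there (`SiegelZero.analyticOrderAt_LFunction_eq_completed`). [folklore] -/
private theorem untop₀_meromorphicOrderAt_completed (hχ : χ ≠ 1) {ρ : ℂ} (h0 : 0 < ρ.re) :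
    (meromorphicOrderAt (completedLFunction χ) ρ).untop₀ = (DirichletDisc.zeroOrder χ ρ : ℤ) := by
  have han : AnalyticAt ℂ (completedLFunction χ) ρ :=
    (differentiable_completedLFunction hχ).analyticAt ρ
  rw [han.meromorphicOrderAt_eq, ← analyticOrderAt_LFunction_eq_completed hχ h0,
    DirichletDisc.zeroOrder,
    ← Nat.cast_analyticOrderNatAt (DirichletDisc.analyticOrderAt_LFunction_ne_top χ hχ ρ)]
  simp

/-- `y ↦ Λ'/Λ(c + iy, χ)` is continuous for `c ≥ 1` (`Λ` entire and zero-free there). [folklore] -/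
private theorem continuous_logDeriv_completed_vertical (hχ : χ ≠ 1) {c : ℝ} (hc : 1 ≤ c) :
    Continuous fun y : ℝ ↦ logDeriv (completedLFunction χ) ((c : ℂ) + y * I) := by
  have hd := differentiable_completedLFunction hχ
  have h1 : Continuous (deriv (completedLFunction χ)) :=
    (hd.contDiff (n := 1)).continuous_deriv le_rfl
  have e : (fun y : ℝ ↦ logDeriv (completedLFunction χ) ((c : ℂ) + y * I)) = fun y : ℝ ↦
      deriv (completedLFunction χ) ((c : ℂ) + y * I) / completedLFunction χ ((c : ℂ) + y * I) :=
    funext fun y ↦ logDeriv_apply _ _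
  rw [e]
  exact (h1.comp (by fun_prop)).div (hd.continuous.comp (by fun_prop)) fun y ↦
    completedLFunction_ne_zero_of_one_le_re hχ (by simpa using hc)

/-- **The residue theorem for `(Λ'/Λ)(s, χ) ĝ(s)` on `[−1/2, 3/2] × [−T, T]`, left edge folded**
(Weil pp. 261–262 / Bombieri §2 for `χ`): if `T > 0` is `±` the ordinate of no non-trivial zero then
`2πi Σ_{|Im ρ| ≤ T} m(ρ) ĝ(ρ) = ∫ (Λ'/Λ ĝ)(x − iT) dx − ∫ (Λ'/Λ ĝ)(x + iT) dx
  + i ∫_{−T}^{T} [Λ'/Λ(s, χ) ĝ(s) + (log q + Λ'/Λ(s, χ̄)) ĝ(1 − s)] dy`, `s = 3/2 + iy`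
(`Λ'/Λ(1 − s, χ) = −log q − Λ'/Λ(s, χ̄)`).
[cite: Weil1952FormulesExplicites, (11) pp. 261–262; Bombieri2000Weil, §2] -/
theorem weilZeroSidePartialChar_eq_contour (hprim : χ.IsPrimitive) (hq : 1 < q) (hg : IsWeilTest g)
    {T : ℝ} (hT : 0 < T)
    (hgood : ∀ ρ : ℂ, χ.LFunction ρ = 0 → 0 < ρ.re → ρ.re < 1 → ρ.im ≠ T ∧ ρ.im ≠ -T) :
    2 * π * I * weilZeroSidePartialChar χ g T =
      (∫ x : ℝ in (-(1 / 2) : ℝ)..(3 / 2), logDeriv (completedLFunction χ) (x + (-T : ℝ) * I) *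
          weilMellin g (x + (-T : ℝ) * I)) -
      (∫ x : ℝ in (-(1 / 2) : ℝ)..(3 / 2), logDeriv (completedLFunction χ) (x + T * I) *
          weilMellin g (x + T * I)) +
      I * ∫ y : ℝ in (-T)..T, (logDeriv (completedLFunction χ) (((3 / 2 : ℝ) : ℂ) + y * I) *
          weilMellin g (((3 / 2 : ℝ) : ℂ) + y * I) +
        ((Real.log q : ℂ) + logDeriv (completedLFunction χ⁻¹) (((3 / 2 : ℝ) : ℂ) + y * I)) *
          weilMellin g (1 - (((3 / 2 : ℝ) : ℂ) + y * I))) := by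
  have hχ : χ ≠ 1 := ne_one_of_isPrimitive hprim hq
  have hχ' : χ⁻¹ ≠ 1 := inv_ne_one.mpr hχ
  have hgc : Continuous g := hg.1.continuous
  -- non-vanishing of `Λ` on the horizontal edges
  have hhor : ∀ t : ℝ, (t = T ∨ t = -T) → ∀ x : ℝ, completedLFunction χ (x + t * I) ≠ 0 := by
    intro t ht x h0
    obtain ⟨hL, h0re, h1re⟩ := LFunction_eq_zero_of_completed hprim hχ h0
    obtain ⟨hne1, hne2⟩ := hgood _ hL h0re h1re
    simp at hne1 hne2
    rcases ht with rfl | rfl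
    · exact hne1 rfl
    · exact hne2 rfl
  have key := Literature.Analysis.Complex.integral_boundary_rect_logDeriv_mul
    (f := completedLFunction χ) (g := weilMellin g)
    (a := -(1 / 2)) (b := 3 / 2) (c := -T) (d := T) (by norm_num) (by linarith)
    (fun z _ ↦ (differentiable_completedLFunction hχ).analyticAt z)
    (analyticOnNhd_weilMellin hgc hg.2 _)
    (fun x _ ↦ by exact_mod_cast hhor (-T) (Or.inr rfl) x) (fun x _ ↦ hhor T (Or.inl rfl) x)
    (fun y _ ↦ completedLFunction_ne_zero_of_re_nonpos hprim hχ (by simp))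
    (fun y _ ↦ completedLFunction_ne_zero_of_one_le_re hχ (by simp; norm_num))
  simp only [← logDeriv_apply] at key
  -- the zero sum
  have hsum : (∑ᶠ ρ ∈ {ρ : ℂ | completedLFunction χ ρ = 0 ∧
      ρ ∈ Ioo (-(1 / 2) : ℝ) (3 / 2) ×ℂ Ioo (-T) T},
      ((meromorphicOrderAt (completedLFunction χ) ρ).untop₀ : ℂ) * weilMellin g ρ) =
      weilZeroSidePartialChar χ g T := by
    have hset : {ρ : ℂ | completedLFunction χ ρ = 0 ∧ ρ ∈ Ioo (-(1 / 2) : ℝ) (3 / 2) ×ℂ Ioo (-T) T} =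
        lfunctionZeroBox χ T := by
      ext ρ
      simp only [mem_setOf_eq, Complex.mem_reProdIm, mem_Ioo, mem_lfunctionZeroBox]
      constructor
      · rintro ⟨h0, -, hi1, hi2⟩
        obtain ⟨hL, hre0, hre1⟩ := LFunction_eq_zero_of_completed hprim hχ h0
        exact ⟨hL, hre0, hre1, abs_le.2 ⟨hi1.le, hi2.le⟩⟩
      · rintro ⟨hL, hre0, hre1, habs⟩
        obtain ⟨hne1, hne2⟩ := hgood ρ hL hre0 hre1
        refine ⟨completed_eq_zero_of_LFunction hχ hL hre0, ⟨by linarith, by linarith⟩, ?_, ?_⟩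
        · exact lt_of_le_of_ne (abs_le.1 habs).1 (Ne.symm hne2)
        · exact lt_of_le_of_ne (abs_le.1 habs).2 hne1
    rw [hset, weilZeroSidePartialChar]
    refine finsum_mem_congr rfl fun ρ hρ ↦ ?_
    rw [untop₀_meromorphicOrderAt_completed hχ hρ.2.1]
    norm_cast
  rw [hsum] at key
  rw [← key]
  -- fold the left edge: `Λ'/Λ(−1/2 + iy, χ) = −log q − Λ'/Λ(3/2 − iy, χ̄)`
  have hleft : (∫ y : ℝ in (-T)..T, logDeriv (completedLFunction χ) (((-(1 / 2) : ℝ) : ℂ) + y * I) *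
      weilMellin g (((-(1 / 2) : ℝ) : ℂ) + y * I)) =
      -∫ y : ℝ in (-T)..T, ((Real.log q : ℂ) +
          logDeriv (completedLFunction χ⁻¹) (((3 / 2 : ℝ) : ℂ) + y * I)) *
        weilMellin g (1 - (((3 / 2 : ℝ) : ℂ) + y * I)) := by
    have e : ∀ y : ℝ, (((-(1 / 2) : ℝ) : ℂ) + y * I) =
        1 - ((((3 / 2 : ℝ) : ℂ) + ((-y : ℝ) : ℂ) * I)) := by
      intro y; push_cast; ring
    have h1 : (fun y : ℝ ↦ logDeriv (completedLFunction χ) (((-(1 / 2) : ℝ) : ℂ) + y * I) *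
        weilMellin g (((-(1 / 2) : ℝ) : ℂ) + y * I)) = fun y : ℝ ↦
        -((fun u : ℝ ↦ ((Real.log q : ℂ) +
            logDeriv (completedLFunction χ⁻¹) (((3 / 2 : ℝ) : ℂ) + u * I)) *
          weilMellin g (1 - (((3 / 2 : ℝ) : ℂ) + u * I))) (-y)) := by
      funext y
      simp only
      rw [e y, logDeriv_completed_one_sub hprim hχ
        (completedLFunction_ne_zero_of_one_le_re hχ' (by simp; norm_num))]
      push_cast
      ring
    rw [h1, intervalIntegral.integral_neg, intervalIntegral.integral_comp_neg (fun u : ℝ ↦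
      ((Real.log q : ℂ) + logDeriv (completedLFunction χ⁻¹) (((3 / 2 : ℝ) : ℂ) + u * I)) *
        weilMellin g (1 - (((3 / 2 : ℝ) : ℂ) + u * I)))]
    simp
  rw [hleft]
  -- combine the two vertical pieces
  have hc1 : Continuous fun y : ℝ ↦ logDeriv (completedLFunction χ) (((3 / 2 : ℝ) : ℂ) + y * I) :=
    continuous_logDeriv_completed_vertical hχ (by norm_num)
  have hc2 : Continuous fun y : ℝ ↦ logDeriv (completedLFunction χ⁻¹) (((3 / 2 : ℝ) : ℂ) + y * I) :=
    continuous_logDeriv_completed_vertical hχ' (by norm_num)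
  have hcg : Continuous (weilMellin g) := continuous_weilMellin hgc hg.2
  have i1 : IntervalIntegrable (fun y : ℝ ↦ logDeriv (completedLFunction χ) (((3 / 2 : ℝ) : ℂ) + y * I) *
      weilMellin g (((3 / 2 : ℝ) : ℂ) + y * I)) volume (-T) T :=
    (hc1.mul (hcg.comp (by fun_prop))).intervalIntegrable _ _
  have i2 : IntervalIntegrable (fun y : ℝ ↦ ((Real.log q : ℂ) +
        logDeriv (completedLFunction χ⁻¹) (((3 / 2 : ℝ) : ℂ) + y * I)) *
      weilMellin g (1 - (((3 / 2 : ℝ) : ℂ) + y * I))) volume (-T) T :=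
    ((continuous_const.add hc2).mul (hcg.comp (by fun_prop))).intervalIntegrable _ _
  rw [intervalIntegral.integral_add i1 i2]
  push_cast
  ring

/-! ### The horizontal sides at good heights -/

/-- **`Λ'/Λ(σ + it, χ)` on `−1/2 ≤ σ ≤ 3/2` at a good height** (MV Lemma 12.7 plus the Gamma
factor): there is an absolute `C` with `‖Λ'/Λ(σ + it, χ)‖ ≤ C (log q + log(|t|+4))/η` whenever
`|t| ≥ 2`, `0 < η ≤ 1` and every non-trivial zero has `|γ − t| ≥ η` (`Λ'/Λ = L'/L + γ'/γ`, the
tree's `ExplicitPsiChar.exists_norm_logDeriv_LFunction_le_strip` and `norm_logDeriv_gammaFactor_le`).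
[cite: MontgomeryVaughan2007, Lemma 12.7] -/
theorem exists_norm_logDeriv_completed_le_strip :
    ∃ C : ℝ, 0 < C ∧ ∀ (q : ℕ) [NeZero q] (χ : DirichletCharacter ℂ q), χ.IsPrimitive → 1 < q →
      ∀ t η : ℝ, 2 ≤ |t| → 0 < η → η ≤ 1 →
        (∀ ρ : ℂ, χ.LFunction ρ = 0 → 0 < ρ.re → ρ.re < 1 → η ≤ |ρ.im - t|) →
        ∀ σ : ℝ, σ ∈ Icc (-(1 / 2) : ℝ) (3 / 2) →
          ‖logDeriv (completedLFunction χ) (σ + t * I)‖ ≤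
            C * (Real.log q + Real.log (|t| + 4)) / η := by
  obtain ⟨C, hC0, hC⟩ := exists_norm_logDeriv_LFunction_le_strip
  refine ⟨C + 7, by linarith, fun q _ χ hprim hq t η ht hη hη1 hZ σ hσ ↦ ?_⟩
  have hχ : χ ≠ 1 := ne_one_of_isPrimitive hprim hq
  obtain ⟨hL, hb⟩ := hC q χ hprim hq t η ht hη hη1 hZ σ hσ
  have ht0 : t ≠ 0 := fun h ↦ by rw [h, abs_zero] at ht; linarith
  have hG : gammaFactor χ (σ + t * I) ≠ 0 := fun h ↦ by
    have := (im_eq_zero_of_gammaFactor_eq_zero χ h).1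
    simp at this
    exact ht0 this
  have hΛ : completedLFunction χ (σ + t * I) ≠ 0 := fun h ↦ by
    apply hL
    rw [LFunction_eq_completed_div_gammaFactor χ _ (Or.inr (level_ne_one hχ)), h, zero_div]
  have heq : logDeriv (completedLFunction χ) (σ + t * I) =
      logDeriv χ.LFunction (σ + t * I) + logDeriv (gammaFactor χ) (σ + t * I) := by
    rw [logDeriv_LFunction_eq hχ hΛ hG]; ring
  have hγ := norm_logDeriv_gammaFactor_le χ hσ.1 (by linarith [hσ.2]) ht
  set ℒ := Real.log q + Real.log (|t| + 4) with hℒ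
  have hℒ1 : 1 ≤ ℒ := DirichletZFR.one_le_ell q t
  have hlog4 : Real.log (|t| + 4) ≤ ℒ := by
    have : 0 ≤ Real.log q := Real.log_natCast_nonneg q
    linarith
  have hℒη : ℒ ≤ ℒ / η := by
    rw [le_div_iff₀ hη]; nlinarith
  rw [heq]
  calc ‖logDeriv χ.LFunction (σ + t * I) + logDeriv (gammaFactor χ) (σ + t * I)‖
      ≤ C * ℒ / η + (Real.log (|t| + 4) / 2 + 6) := norm_add_le_of_le hb hγ
    _ ≤ C * ℒ / η + 7 * (ℒ / η) := by
        have : Real.log (|t| + 4) / 2 + 6 ≤ 7 * (ℒ / η) := by linarith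
        linarith
    _ = (C + 7) * ℒ / η := by ring

/-- The horizontal sides at a good height: for `T ≥ 2`, `0 < η ≤ 1` with all non-trivial zeros
`η`-away from the ordinates `±T`, and `t = ±T`,
`‖∫_{−1/2}^{3/2} (Λ'/Λ)(x + it, χ) ĝ(x + it) dx‖ ≤ 2 · (C ℒ_T/η) · D₃/(1+T²)³`,
`ℒ_T = log q + log(T + 4)`, `D₃ = weilDecayW3 1 g`. [cite: Bombieri2000Weil, §2] -/
theorem norm_horizontal_le_char (hg : IsWeilTest g) {C : ℝ}
    (hC : ∀ t η : ℝ, 2 ≤ |t| → 0 < η → η ≤ 1 →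
      (∀ ρ : ℂ, χ.LFunction ρ = 0 → 0 < ρ.re → ρ.re < 1 → η ≤ |ρ.im - t|) →
      ∀ σ : ℝ, σ ∈ Icc (-(1 / 2) : ℝ) (3 / 2) →
        ‖logDeriv (completedLFunction χ) (σ + t * I)‖ ≤
          C * (Real.log q + Real.log (|t| + 4)) / η)
    {T η : ℝ} (hT : 2 ≤ T) (hη : 0 < η) (hη1 : η ≤ 1)
    (hZ : ∀ ρ : ℂ, χ.LFunction ρ = 0 → 0 < ρ.re → ρ.re < 1 → η ≤ |(|ρ.im|) - T|) {t : ℝ}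
    (ht : t = T ∨ t = -T) :
    ‖∫ x : ℝ in (-(1 / 2) : ℝ)..(3 / 2), logDeriv (completedLFunction χ) (x + t * I) *
        weilMellin g (x + t * I)‖ ≤
      2 * (C * (Real.log q + Real.log (T + 4)) / η) * (weilDecayW3 1 g / (1 + T ^ 2) ^ 3) := by
  have hT0 : 0 ≤ T := by linarith
  have htabs : |t| = T := by
    rcases ht with rfl | rfl
    · exact abs_of_nonneg hT0
    · rw [abs_neg, abs_of_nonneg hT0]
  have hZ' : ∀ ρ : ℂ, χ.LFunction ρ = 0 → 0 < ρ.re → ρ.re < 1 → η ≤ |ρ.im - t| := by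
    intro ρ h0 h1 h2
    obtain ⟨hm, hp⟩ := dist_of_abs_sub_le hT0 (hZ ρ h0 h1 h2)
    rcases ht with rfl | rfl
    · exact hm
    · rw [sub_neg_eq_add]; exact hp
  have hpt : ∀ x ∈ Icc (-(1 / 2) : ℝ) (3 / 2),
      ‖logDeriv (completedLFunction χ) (x + t * I) * weilMellin g (x + t * I)‖ ≤
        (C * (Real.log q + Real.log (T + 4)) / η) * (weilDecayW3 1 g / (1 + T ^ 2) ^ 3) := by
    intro x hx
    rw [norm_mul]
    have h1 : ‖logDeriv (completedLFunction χ) (x + t * I)‖ ≤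
        C * (Real.log q + Real.log (T + 4)) / η := by
      have := hC t η (by rw [htabs]; exact hT) hη hη1 hZ' x hx
      rwa [htabs] at this
    have h2 : ‖weilMellin g (x + t * I)‖ ≤ weilDecayW3 1 g / (1 + T ^ 2) ^ 3 := by
      have := norm_weilMellin_le_cube hg (A := 1) (s := x + t * I)
        (by simp; exact abs_le.2 ⟨by linarith [hx.1], by linarith [hx.2]⟩)
      have ht2 : t ^ 2 = T ^ 2 := by rcases ht with rfl | rfl <;> ring
      simpa [ht2] using this
    have h0 : 0 ≤ C * (Real.log q + Real.log (T + 4)) / η := le_trans (norm_nonneg _) h1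
    exact mul_le_mul h1 h2 (norm_nonneg _) h0
  have h := intervalIntegral.norm_integral_le_of_norm_le_const (a := (-(1 / 2) : ℝ)) (b := 3 / 2)
    (f := fun x : ℝ ↦ logDeriv (completedLFunction χ) (x + t * I) * weilMellin g (x + t * I))
    (C := (C * (Real.log q + Real.log (T + 4)) / η) * (weilDecayW3 1 g / (1 + T ^ 2) ^ 3))
    fun x hx ↦ by
      rw [uIoc_of_le (by norm_num)] at hx
      exact hpt x ⟨hx.1.le, hx.2⟩
  refine h.trans (le_of_eq ?_)
  rw [show |(3 : ℝ) / 2 - -(1 / 2)| = 2 by norm_num]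
  ring

omit [NeZero q] in
/-- Bookkeeping for the horizontal sides: with `1 ≤ N ≤ T`, `ℒ ≤ K T` and `1/η ≤ ℒ/c₀ + 1`,
the bound `2 (C ℒ/η) W/(1+T²)³` is at most `2 C W K (K/c₀ + 1)/N`. [folklore] -/
private theorem horizontal_bound_aux_char {C W K c₀ ℒ T η : ℝ} (hC : 0 ≤ C) (hW : 0 ≤ W) (hK : 0 ≤ K)
    (hc₀ : 0 < c₀) {N : ℕ} (hN : 1 ≤ N) (hT1 : (N : ℝ) ≤ T) (hη : 0 < η)
    (hLK : ℒ ≤ K * T) (hηinv : 1 / η ≤ ℒ / c₀ + 1) :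
    2 * (C * ℒ / η) * (W / (1 + T ^ 2) ^ 3) ≤ 2 * C * W * K * (K / c₀ + 1) / N := by
  have hN' : (1 : ℝ) ≤ N := by exact_mod_cast hN
  have hT0 : 1 ≤ T := hN'.trans hT1
  have hTpos : 0 < T := by linarith
  have hinv : 1 / η ≤ (K / c₀ + 1) * T := by
    calc 1 / η ≤ ℒ / c₀ + 1 := hηinv
      _ ≤ K * T / c₀ + T := by gcongr
      _ = (K / c₀ + 1) * T := by ring
  have h1 : C * ℒ / η ≤ C * (K * T) * ((K / c₀ + 1) * T) := by
    rw [show C * ℒ / η = C * ℒ * (1 / η) by ring]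
    gcongr
  have hden : W / (1 + T ^ 2) ^ 3 ≤ W / T ^ 3 := by
    refine div_le_div_of_nonneg_left hW (by positivity) ?_
    have hT' : T ≤ 1 + T ^ 2 := by nlinarith [sq_nonneg (T - 1)]
    exact pow_le_pow_left₀ hTpos.le hT' 3
  have hM : 0 ≤ 2 * C * W * K * (K / c₀ + 1) := by positivity
  have hstep : 2 * (C * ℒ / η) * (W / (1 + T ^ 2) ^ 3) ≤
      2 * (C * (K * T) * ((K / c₀ + 1) * T)) * (W / T ^ 3) :=
    mul_le_mul (mul_le_mul_of_nonneg_left h1 (by norm_num)) hden (by positivity) (by positivity)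
  have heq : 2 * (C * (K * T) * ((K / c₀ + 1) * T)) * (W / T ^ 3) =
      2 * C * W * K * (K / c₀ + 1) / T := by
    field_simp
  rw [heq] at hstep
  exact hstep.trans (div_le_div_of_nonneg_left hM (by linarith) hT1)

/-! ### The zero side converges absolutely -/

/-- **Summability of the zero side** for a test function: `Σ_ρ ‖m(ρ) ĝ(ρ)‖ < ∞` over the
non-trivial zeros of `L(s, χ)` (`|ĝ(ρ)| ≤ D/(1+γ²)` in the strip, `norm_weilMellin_le`, and
`Σ m(ρ)/(1+γ²) < ∞`, `summable_zeroOrder_div_one_add_sq`). [cite: MontgomeryVaughan2007, Theorem 10.17] -/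
theorem summable_norm_zeroSideChar (hprim : χ.IsPrimitive) (hq : 1 < q) (hg : IsWeilTest g) :
    Summable fun ρ : charNontrivialZeros χ ↦
      ‖(DirichletDisc.zeroOrder χ (ρ : ℂ) : ℂ) * weilMellin g ρ‖ := by
  refine summable_of_norm_le_mul_zeroOrder_div hprim hq (B := weilDecayConst g) fun ρ ↦ ?_
  obtain ⟨-, h0, h1⟩ := ρ.2
  have hĝ : ‖weilMellin g ρ‖ ≤ weilDecayConst g / (1 + (ρ : ℂ).im ^ 2) :=
    norm_weilMellin_le hg h0.le h1.le
  rw [norm_mul, Complex.norm_natCast]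
  calc (DirichletDisc.zeroOrder χ (ρ : ℂ) : ℝ) * ‖weilMellin g ρ‖
      ≤ (DirichletDisc.zeroOrder χ (ρ : ℂ) : ℝ) * (weilDecayConst g / (1 + (ρ : ℂ).im ^ 2)) :=
        mul_le_mul_of_nonneg_left hĝ (Nat.cast_nonneg _)
    _ = weilDecayConst g * ((DirichletDisc.zeroOrder χ (ρ : ℂ) : ℝ) / (1 + (ρ : ℂ).im ^ 2)) := by
        ring

end WeilExplicitDirichletProofs

/-! ### Assembly -/

open WeilExplicitDirichletProofs ExplicitPsiChar DirichletCharacter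
  Literature.NumberTheory.LFunctions.SiegelZero in
/-- **DISCHARGE of `Literature.NumberTheory.LFunctions.explicit_formula_dirichlet`: Weil's explicit
formula (11) for a primitive Dirichlet character `χ` modulo `q ≠ 1`** (Weil 1952, `k = ℚ`; the
contour argument of Bombieri 2000 §2 transposed to `Λ(s, χ)`): for every smooth compactly supported
`g`, `lim_{T→∞} Σ_{|Im ρ| ≤ T} m_χ(ρ) ĝ(ρ) = weilFunctionalChar χ g`.
[cite: Weil1952FormulesExplicites, (11) pp. 261–262; Bombieri2000Weil, §2 Thm. 2; MontgomeryVaughan2007, Theorem 12.13] -/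
theorem explicit_formula_dirichlet_holds : explicit_formula_dirichlet := by
  intro q _ χ hq1 hprim g hg
  have hq : 1 < q := lt_of_le_of_ne NeZero.one_le (Ne.symm hq1)
  have hχ : χ ≠ 1 := ne_one_of_isPrimitive hprim hq
  -- the zero side converges absolutely, to `Z`
  set Z : ℂ := ∑' ρ : charNontrivialZeros χ,
    (DirichletDisc.zeroOrder χ (ρ : ℂ) : ℂ) * weilMellin g ρ with hZdef
  have hZ : HasWeilZeroSideChar χ g Z :=
    WeilConverseChar.hasWeilZeroSideChar_tsum hχ (summable_norm_zeroSideChar hprim hq hg)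
  suffices hZW : Z = weilFunctionalChar χ g by rwa [hZW] at hZ
  -- the right edge
  obtain ⟨hΦi, hVinf⟩ := integral_rightEdge hq1 hχ hg
  set Φ : ℝ → ℂ := fun y : ℝ ↦ logDeriv (completedLFunction χ) (((3 / 2 : ℝ) : ℂ) + y * I) *
      weilMellin g (((3 / 2 : ℝ) : ℂ) + y * I) +
    ((Real.log q : ℂ) + logDeriv (completedLFunction χ⁻¹) (((3 / 2 : ℝ) : ℂ) + y * I)) *
      weilMellin g (1 - (((3 / 2 : ℝ) : ℂ) + y * I)) with hΦ
  -- good heights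
  obtain ⟨c₀, hc₀, hH⟩ := exists_goodHeight
  have hex : ∀ N : ℕ, ∃ T ∈ Icc (N : ℝ) (N + 1), ∀ ρ : ℂ, χ.LFunction ρ = 0 → 0 < ρ.re →
      ρ.re < 1 → c₀ / (Real.log q + Real.log (|T| + 4)) ≤ |(|ρ.im|) - T| :=
    fun N ↦ hH q χ hprim hq N (Nat.cast_nonneg N)
  choose T hTmem hTZ using hex
  have hT1 : ∀ N : ℕ, (N : ℝ) ≤ T N := fun N ↦ (hTmem N).1
  have hT2 : ∀ N : ℕ, T N ≤ N + 1 := fun N ↦ (hTmem N).2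
  have hT0 : ∀ N, 0 ≤ T N := fun N ↦ (Nat.cast_nonneg N).trans (hT1 N)
  have hTtop : Tendsto T atTop atTop := tendsto_atTop_mono hT1 tendsto_natCast_atTop_atTop
  set η : ℕ → ℝ := fun N ↦ min (c₀ / (Real.log q + Real.log (|T N| + 4))) 1 with hη
  have hℒ1 : ∀ N, 1 ≤ Real.log q + Real.log (|T N| + 4) := fun N ↦ DirichletZFR.one_le_ell q (T N)
  have hη0 : ∀ N, 0 < η N := fun N ↦ lt_min (div_pos hc₀ (by linarith [hℒ1 N])) one_pos
  have hη1 : ∀ N, η N ≤ 1 := fun N ↦ min_le_right _ _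
  have hηZ : ∀ N, ∀ ρ : ℂ, χ.LFunction ρ = 0 → 0 < ρ.re → ρ.re < 1 →
      η N ≤ |(|ρ.im|) - T N| :=
    fun N ρ h0 h1 h2 ↦ (min_le_left _ _).trans (hTZ N ρ h0 h1 h2)
  have hηinv : ∀ N, 1 / η N ≤ (Real.log q + Real.log (|T N| + 4)) / c₀ + 1 := by
    intro N
    have hpos : 0 < Real.log q + Real.log (|T N| + 4) := by linarith [hℒ1 N]
    rcases le_total (c₀ / (Real.log q + Real.log (|T N| + 4))) 1 with h | h
    · rw [show η N = c₀ / (Real.log q + Real.log (|T N| + 4)) from min_eq_left h, one_div_div]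
      linarith [div_nonneg hpos.le hc₀.le]
    · rw [show η N = 1 from min_eq_right h]
      have : 0 ≤ (Real.log q + Real.log (|T N| + 4)) / c₀ := div_nonneg hpos.le hc₀.le
      linarith
  have hgood : ∀ N, 1 ≤ N → ∀ ρ : ℂ, χ.LFunction ρ = 0 → 0 < ρ.re → ρ.re < 1 →
      ρ.im ≠ T N ∧ ρ.im ≠ -T N := by
    intro N hN ρ h0 h1 h2
    obtain ⟨hm, hp⟩ := dist_of_abs_sub_le (hT0 N) (hηZ N ρ h0 h1 h2)
    constructor
    · intro h; rw [h, sub_self, abs_zero] at hm; linarith [hη0 N]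
    · intro h; rw [h, neg_add_cancel, abs_zero] at hp; linarith [hη0 N]
  -- the pieces of the contour
  set bot : ℕ → ℂ := fun N ↦ ∫ x : ℝ in (-(1 / 2) : ℝ)..(3 / 2),
    logDeriv (completedLFunction χ) (x + (-T N : ℝ) * I) * weilMellin g (x + (-T N : ℝ) * I)
    with hbot
  set top : ℕ → ℂ := fun N ↦ ∫ x : ℝ in (-(1 / 2) : ℝ)..(3 / 2),
    logDeriv (completedLFunction χ) (x + T N * I) * weilMellin g (x + T N * I) with htop
  set V : ℕ → ℂ := fun N ↦ ∫ y : ℝ in (-T N)..T N, Φ y with hV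
  set Vinf : ℂ := ∫ y : ℝ, Φ y with hVinfdef
  -- the contour identity along the good heights
  have hident : ∀ N : ℕ, 2 ≤ N →
      weilZeroSidePartialChar χ g (T N) = (bot N - top N + I * V N) / (2 * π * I) := by
    intro N hN
    have hN' : (2 : ℝ) ≤ N := by exact_mod_cast hN
    have hTpos : 0 < T N := by linarith [hT1 N]
    have h := weilZeroSidePartialChar_eq_contour hprim hq hg hTpos
      (hgood N (le_trans (by norm_num) hN))
    have h2πI : (2 * π * I : ℂ) ≠ 0 := by simp [Real.pi_ne_zero, I_ne_zero]
    rw [eq_div_iff h2πI, mul_comm, h]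
  -- limits of the pieces
  obtain ⟨C, hC0, hC⟩ := exists_norm_logDeriv_completed_le_strip
  have hlogq : 0 ≤ Real.log q := Real.log_natCast_nonneg q
  have hedge : ∀ e : ℝ, (e = 1 ∨ e = -1) → Tendsto (fun N : ℕ ↦ ∫ x : ℝ in (-(1 / 2) : ℝ)..(3 / 2),
      logDeriv (completedLFunction χ) (x + (e * T N : ℝ) * I) *
        weilMellin g (x + (e * T N : ℝ) * I)) atTop (𝓝 0) := by
    intro e he
    rw [tendsto_zero_iff_norm_tendsto_zero]
    have hM := tendsto_const_div_atTop_nhds_zero_nat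
      (2 * C * weilDecayW3 1 g * (Real.log q + 4) * ((Real.log q + 4) / c₀ + 1))
    refine squeeze_zero' (Eventually.of_forall fun _ ↦ norm_nonneg _)
      ((eventually_ge_atTop 2).mono fun N hN ↦ ?_) hM
    have hN' : (2 : ℝ) ≤ N := by exact_mod_cast hN
    have hTN : 2 ≤ T N := by linarith [hT1 N]
    have hTabs : |T N| = T N := abs_of_nonneg (hT0 N)
    have het : e * T N = T N ∨ e * T N = -T N := by
      rcases he with rfl | rfl
      · exact Or.inl (one_mul _)
      · exact Or.inr (neg_one_mul _)
    refine (norm_horizontal_le_char hg (hC q χ hprim hq) hTN (hη0 N) (hη1 N) (hηZ N) het).trans ?_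
    have hLK : Real.log q + Real.log (T N + 4) ≤ (Real.log q + 4) * T N := by
      have h1 : Real.log (T N + 4) ≤ T N + 3 := by
        have := Real.log_le_sub_one_of_pos (by linarith : 0 < T N + 4); linarith
      nlinarith
    refine horizontal_bound_aux_char hC0.le (weilDecayW3_nonneg _ _) (by linarith) hc₀
      (le_trans (by norm_num) hN) (hT1 N) (hη0 N) hLK ?_
    have := hηinv N
    rwa [hTabs] at this
  have hbot_lim : Tendsto bot atTop (𝓝 0) := by
    refine (hedge (-1) (Or.inr rfl)).congr fun N ↦ ?_
    simp [hbot]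
  have htop_lim : Tendsto top atTop (𝓝 0) := by
    refine (hedge 1 (Or.inl rfl)).congr fun N ↦ ?_
    simp [htop]
  have hV_lim : Tendsto V atTop (𝓝 Vinf) :=
    intervalIntegral_tendsto_integral hΦi (tendsto_neg_atTop_atBot.comp hTtop) hTtop
  have hrhs : Tendsto (fun N ↦ (bot N - top N + I * V N) / (2 * π * I)) atTop
      (𝓝 ((0 - 0 + I * Vinf) / (2 * π * I))) :=
    ((hbot_lim.sub htop_lim).add (hV_lim.const_mul I)).div_const _
  -- the zero side along the good heights
  have hS : Tendsto (fun N ↦ weilZeroSidePartialChar χ g (T N)) atTop (𝓝 Z) := hZ.comp hTtop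
  have hS' : Tendsto (fun N ↦ weilZeroSidePartialChar χ g (T N)) atTop
      (𝓝 ((0 - 0 + I * Vinf) / (2 * π * I))) :=
    hrhs.congr' ((eventually_ge_atTop 2).mono fun N hN ↦ (hident N hN).symm)
  have hlim := tendsto_nhds_unique hS hS'
  rw [hlim, hVinf]
  have h2πI : (2 * π * I : ℂ) ≠ 0 := by simp [Real.pi_ne_zero, I_ne_zero]
  field_simp
  ring



/-! ### Corollaries: Weil's criterion for `L(s, χ)` on `C_c^∞`, unconditionally -/

section Corollaries

variable {q : ℕ} [NeZero q] {χ : DirichletCharacter ℂ q}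

/-- **GRH(χ) ⇒ Weil positivity on all of `C_c^∞`**, unconditionally (the tree's
`WeilPositivityChar.of_riemannHypothesis` fed with `explicit_formula_dirichlet_holds`; Weil p. 262,
«il faut»). [cite: Weil1952FormulesExplicites, the «lemme» p. 262; Bombieri2000Weil, Theorem 1] -/
theorem WeilPositivityChar.of_grh (hq : q ≠ 1) (hprim : χ.IsPrimitive)
    (hGRH : χ.RiemannHypothesis) : WeilPositivityChar χ :=
  WeilPositivityChar.of_riemannHypothesis explicit_formula_dirichlet_holds hq hprim hGRH

/-- **Weil's criterion for a primitive Dirichlet `L`-function on `C_c^∞`** (Weil 1952 p. 262 /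
Bombieri 2000 Thm. 1, for `L(s, χ)`), now unconditional: for `χ` primitive modulo `q ≠ 1`,
`GRH(χ) ↔ (∀ g ∈ C_c^∞, W_χ(g * g̃) ≥ 0)`.
[cite: Weil1952FormulesExplicites, the «lemme» p. 262; Bombieri2000Weil, Theorem 1] -/
theorem weil_criterion_dirichlet (hq : q ≠ 1) (hprim : χ.IsPrimitive) :
    χ.RiemannHypothesis ↔ WeilPositivityChar χ :=
  weil_criterion_dirichlet_of_explicitFormula explicit_formula_dirichlet_holds hq hprim

/-- **The rung family is equivalent to GRH(χ)**, unconditionally: for `χ` primitive modulo `q ≠ 1`,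
`GRH(χ) ↔ ∀ t, WeilPositivityOnChar χ t` (Yoshida's compact-support filtration, `χ`-version).
[cite: Bombieri2000Weil, Theorem 1; Yoshida1992, §0] -/
theorem riemannHypothesis_iff_forall_weilPositivityOnChar_holds (hq : q ≠ 1) (hprim : χ.IsPrimitive) :
    χ.RiemannHypothesis ↔ ∀ t : ℝ, WeilPositivityOnChar χ t :=
  riemannHypothesis_iff_forall_weilPositivityOnChar explicit_formula_dirichlet_holds hq hprim

end Corollaries

end Literature.NumberTheory.LFunctions

end
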